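import Literature.AlgebraicGeometry.Motives.SymmetricPowerProjective
import Literature.AlgebraicGeometry.Motives.FiniteQuotientProjective
import Literature.AlgebraicGeometry.Motives.SegreEmbedding
import Literature.AlgebraicGeometry.Motives.VarietiesUnitProofs
import HarnessLib

/-!
# The fibre powers `Cⁿ` and the symmetric powers `C⁽ⁿ⁾ = Cⁿ/𝔖ₙ` of a projective `k`-scheme are projective
# (Milne, *Jacobian Varieties*, §3 Prop. 3.1)

Topic `AlgebraicGeometry/Motives`; namespace `Literature.AlgebraicGeometry.Motives`. THEOREMS ONLY (no definition, no named fact,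
no instance, no `sorry`). The item «not covered here: `C⁽ⁿ⁾` is of finite type (hence proper) / a variety» of ★
`Motives/SymmetricPowerProjective` (`symPowProj C hC n`: the symmetric power as a `k`-scheme with its universal property):

* `isProjectiveOver_powOverObj` — the `n`-fold fibre power `Cⁿ = C ×ₖ ⋯ ×ₖ C` (★ `RelativeSpec.powOverObj`, Mathlib's wide
  pullback) of a projective `k`-scheme is projective (induction: `C⁰ = Spec k` ★ `isProjectiveOver_unit`,
  `Cⁿ⁺¹ ≅ Cⁿ ×ₖ C` ★ `powSuccIso`, products of projectives are projective by the Segre embedding ★ `IsProjectiveOver.tensor`);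
* **`isProjectiveOver_symPowProj`** — `C⁽ⁿ⁾ = Cⁿ/𝔖ₙ` is PROJECTIVE over `k` (Milne JV §3 Prop. 3.1 «the quotient
  `C^{(r)} = Cʳ/S_r` exists as a (projective) variety»): it is the finite quotient ★ `Motives.finiteQuotient` of the projective
  `Cⁿ` by the permutation action, projective by ★ `isProjectiveOver_finiteQuotient` (`Motives/FiniteQuotientProjective`: norms of
  forms, Mumford AV §7 Remark p. 69). Consequences recorded: `C⁽ⁿ⁾ → Spec k` is proper and (locally) of finite type.

Cell `hodgecm-mathlib`, count-neutral capital (HC_CM is proved only modulo the 7 printed citations until rung 0 closes; this file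
discharges none of them).

## References
* J. S. Milne, *Jacobian Varieties* (in *Arithmetic Geometry*, 1986), §3 Prop. 3.1. [Milne1986JacobianVarieties]
* D. Mumford, *Abelian Varieties* (1970), §7 Theorem p. 66 and Remark p. 69. [MumfordAV1970]
* R. Hartshorne, *Algebraic Geometry* (1977), II Ex. 4.9 (Segre: products of projective schemes). [Hartshorne1977]
-/

noncomputable section

universe u

open CategoryTheory Limits AlgebraicGeometry MonoidalCategory
open Literature.AlgebraicGeometry.RelativeSpec

namespace Literature.AlgebraicGeometry.Motives

variable {k : Type u} [Field k]

/-- Projectivity over `k` is invariant under isomorphisms of `k`-schemes (a private copy of the evident fact: precompose the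
closed immersion into `ℙⁿ_k` with the isomorphism). [folklore] -/
private theorem isProjectiveOver_of_iso' {S S' : SchemeOver k} (i : S ≅ S') (h : IsProjectiveOver S') :
    IsProjectiveOver S := by
  obtain ⟨n, κ, hκ⟩ := h
  haveI := hκ
  exact ⟨n, i.hom ≫ κ, inferInstanceAs (IsClosedImmersion (i.hom.left ≫ κ.left))⟩

/-! ### Fibre powers -/

section Pow

variable (C : SchemeOver k)

/-- `C⁰ = Spec k`: the zeroth fibre power (the wide pullback of the empty family) is the base, i.e. the tensor unit of
`SchemeOver k`. [cite: Milne1986JacobianVarieties, §3 Prop. 3.1] -/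
theorem nonempty_powOverObj_zero_iso_tensorUnit : Nonempty (powOverObj C.hom 0 ≅ 𝟙_ (SchemeOver k)) := by
  -- the inverse `Spec k ⟶ C⁰` (no components to give)
  let inv : Spec (.of k) ⟶ powOver C.hom 0 :=
    WidePullback.lift (objs := fun _ : Fin 0 ↦ C.left) (arrows := fun _ ↦ C.hom) (𝟙 (Spec (.of k)))
      (fun i ↦ Fin.elim0 i) (fun i ↦ Fin.elim0 i)
  have h₁ : inv ≫ powOver.base C.hom 0 = 𝟙 (Spec (.of k)) := WidePullback.lift_base _ _ _ _
  have h₂ : powOver.base C.hom 0 ≫ inv = 𝟙 (powOver C.hom 0) := by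
    apply WidePullback.hom_ext
    · intro i; exact Fin.elim0 i
    · rw [Category.assoc, h₁, Category.comp_id, Category.id_comp]
  let e : powOver C.hom 0 ≅ Spec (.of k) := ⟨powOver.base C.hom 0, inv, h₂, h₁⟩
  exact ⟨Over.isoMk e (Category.comp_id _)⟩

/-- `Cⁿ⁺¹ ≅ Cⁿ ×ₖ C` as `k`-schemes (★ `powSuccIso`, in the cartesian monoidal structure of `SchemeOver k`).
[cite: Milne1986JacobianVarieties, §3 Prop. 3.1] -/
theorem nonempty_powOverObj_succ_iso_tensor (n : ℕ) :
    Nonempty (powOverObj C.hom (n + 1) ≅ powOverObj C.hom n ⊗ C) := by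
  refine ⟨Over.isoMk (powSuccIso C.hom n) ?_⟩
  change powSuccToPullback C.hom n ≫ pullback.fst (powOver.base C.hom n) C.hom ≫ powOver.base C.hom n =
    powOver.base C.hom (n + 1)
  exact powSuccToPullback_fst_base C.hom n

/-- **The fibre powers `Cⁿ = C ×ₖ ⋯ ×ₖ C` of a projective `k`-scheme are projective** (induction over `Cⁿ⁺¹ ≅ Cⁿ ×ₖ C` with
the Segre embedding, ★ `IsProjectiveOver.tensor`; `C⁰ = Spec k` is projective, ★ `isProjectiveOver_unit`).
[cite: Hartshorne1977, II Ex. 4.9] [cite: Milne1986JacobianVarieties, §3 Prop. 3.1] -/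
theorem isProjectiveOver_powOverObj (hC : IsProjectiveOver C) (n : ℕ) : IsProjectiveOver (powOverObj C.hom n) := by
  induction n with
  | zero =>
    obtain ⟨e⟩ := nonempty_powOverObj_zero_iso_tensorUnit C
    exact isProjectiveOver_of_iso' e (isProjectiveOver_unit k)
  | succ n ih =>
    obtain ⟨e⟩ := nonempty_powOverObj_succ_iso_tensor C n
    exact isProjectiveOver_of_iso' e (ih.tensor hC)

end Pow

/-! ### Symmetric powers -/

section SymPow

variable (C : SchemeOver k) (hC : IsProjectiveOver C) (n : ℕ)

/-- The symmetric power `C⁽ⁿ⁾` of ★ `SymmetricPowerProjective` IS the finite quotient ★ `Motives.finiteQuotient` of `Cⁿ` by the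
permutation action `𝔖ₙ` (both are the glued quotient `ActionOver.glued` with the descended structure morphism; definitional).
[cite: Milne1986JacobianVarieties, §3 Prop. 3.1] -/
theorem symPowProj_eq_finiteQuotient :
    haveI : IsSeparated (powOverObj C.hom n).hom := haveI := hC.isSeparated; isSeparated_powOver_base (r := C.hom) n
    symPowProj C hC n = finiteQuotient (X := powOverObj C.hom n) (permAction C.hom n) := rfl

/-- **THE SYMMETRIC POWER `C⁽ⁿ⁾ = Cⁿ/𝔖ₙ` OF A PROJECTIVE `k`-SCHEME IS PROJECTIVE** (Milne JV §3 Prop. 3.1: «the quotient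
`C^{(r)} = Cʳ/S_r` exists as a variety», projective with `C`; Mumford AV §7 Remark p. 69): `Cⁿ` is projective
(`isProjectiveOver_powOverObj`) and the quotient of a projective `k`-scheme by a finite group is projective (★
`isProjectiveOver_finiteQuotient`). [cite: Milne1986JacobianVarieties, §3 Prop. 3.1] [cite: MumfordAV1970, §7 Thm. p. 66 and Remark p. 69] -/
theorem isProjectiveOver_symPowProj : IsProjectiveOver (symPowProj C hC n) := by
  haveI : IsSeparated (powOverObj C.hom n).hom := haveI := hC.isSeparated; isSeparated_powOver_base (r := C.hom) n
  rw [symPowProj_eq_finiteQuotient]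
  exact isProjectiveOver_finiteQuotient (X := powOverObj C.hom n) (permAction C.hom n) (isProjectiveOver_powOverObj C hC n)

/-- `C⁽ⁿ⁾ → Spec k` is proper. [cite: Milne1986JacobianVarieties, §3 Prop. 3.1] -/
theorem isProper_symPowProj_hom : IsProper (symPowProj C hC n).hom :=
  (isProjectiveOver_symPowProj C hC n).isProper

/-- `C⁽ⁿ⁾ → Spec k` is locally of finite type (`C⁽ⁿ⁾` is a scheme of finite type over `k`).
[cite: Milne1986JacobianVarieties, §3 Prop. 3.1] -/
theorem locallyOfFiniteType_symPowProj_hom : LocallyOfFiniteType (symPowProj C hC n).hom :=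
  haveI := isProper_symPowProj_hom C hC n
  inferInstance

end SymPow

end Literature.AlgebraicGeometry.Motives

end
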